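import Summits.CriticalPhenomena.PercolationContinuityZ3.Theorems.PercNearOneGluingNoHeavyConstsHardCoreHarrisOne
import HarnessLib

/-!
# The cross-reach row X(T) at measure level holds whenever `μ(S ↮ T) ≤ μ(S ↔ T)` (PAPER-2 track (ii), refinements of
# the fibrewise hard-core Harris programme)

builds on p205010 (kernel theorem, internal audit signed; external expert review pending).  Support file (`--supports
stmt-CriticalPhenomena-4575`), lane `prim-facecert` (gen 15), on the lead's rows of `run/shared/lean/prim/prim-nh-lead-4575/LEAD-GEN106.md`
§2 (`Consts.CrossReachBHK`, typed fibrewise in `…ConstsOneCopyBHK.lean`).  Theorems only; no sorries; standard axioms.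

CONTEXT.  Two INDEPENDENT copies `ω₀, ω₁ ~ μ = prodBernoulli w`, a source set `S`, a vertex set `T`, `U = {S ↔ T}` (some vertex of `T`
is joined to `S`), `D = Uᶜ = {S ↮ T}`, increasing cluster events `A = {P(C_S)}`, `B = {Q(C_S)}`, `∇a = 1_A(ω₀) − 1_A(ω₁)`.  The lead's
CROSS-REACH row is the `w = 1` stratum `X(T) = E⊗E[1_U(ω₀) 1_D(ω₁) ∇a ∇b]` ("copy 0 reaches `T`, copy 1 avoids `T`"); expanding,
`X(T) = μ(ABU)·μ(D) + μ(ABD)·μ(U) − μ(AU)·μ(BD) − μ(BU)·μ(AD)`, and with `r = μ(U)`, `d = μ(D)` and conditional laws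
`X(T) = r·d·[Cov(A,B | U) + Cov(A,B | D) + (μ(A|U) − μ(A|D))(μ(B|U) − μ(B|D))]`.
Harris gives `Cov(A,B) = r·Cov_U + d·Cov_D + r·d·cross ≥ 0`, BHK's Theorem 1.3 gives `Cov_D ≥ 0`, Harris (increasing vs decreasing)
gives `cross ≥ 0`; `Cov_U` may be NEGATIVE ("positive association given `S ↔ v`" is false, memo §2(4)).
* `Consts.crossReach_measure_of_disconnect_le` — **THEOREM (this file): if `μ(S ↮ T) ≤ μ(S ↔ T)` then `X(T) ≥ 0`**, i.e.
  `μ(A ∩ U)·μ(B ∩ D) + μ(B ∩ U)·μ(A ∩ D) ≤ μ(A ∩ B ∩ U)·μ(D) + μ(A ∩ B ∩ D)·μ(U)`, for every finite vertex type, all weights, all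
  `S, T` and increasing `P, Q`.  Proof: the polynomial identity
  `d·X = d²·[μ(AB) − μ(A)μ(B)] + (r − d)·[d·μ(ABD) − μ(AD)μ(BD)] + [dμ(A) − μ(AD)]·[dμ(B) − μ(BD)]` (`Consts.crossReach_half_algebra`)
  with Harris, BHK's Theorem 1.3 with sets (`setClusterEventExchange`) and the two mixed Harris bounds; `r ≥ d` makes the middle
  coefficient nonnegative.  So at measure level the cross-reach row is a consequence of Harris + BHK exactly in the regime
  `μ(S ↔ T) ≥ ½`; for `μ(S ↔ T) < ½` the row is FALSE IN GENERAL — settled after this file landed by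
  `Consts.not_crossReach_measure` (`…ConstsCrossReachMeasureRefutation.lean`, lane gen 16, kernel `decide` over `2¹¹` configurations):
  on `G₈ = {03, 04, 13, 15, 24, 25, 35, 45, 16, 56, 07}` (the containment witness `G₇` plus a light pendant `07`, `w07 = 1/200`) with
  `S = {5}`, `T = {7}`, `P = [2 ∈ V(C)]`, `Q = [6 ∈ V(C)]` one has `X = −1.34·10⁻¹⁵ < 0` at `μ(S ↔ T) = 4.4·10⁻⁴` (pendant identity
  `X_G(v) = t·[X_{G−v}(h) + 2(1−t)·K₂(h)]`, so a negative containment row behind a light pendant gives a negative cross-reach row).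
  The earlier probe recorded here (0 violations among all up-set pairs on every rooted graph with ≤ 5 vertices under corner-biased
  weights, 4.1·10⁷ instances, and in weight-optimising searches on 6–7 vertices) missed it: the violation needs eight vertices and an
  interior pendant weight (for VERTEX events `[x ∈ V(C)]` eight vertices are needed).  **The hypothesis is SHARP**
  (`Consts.crossReach_measure_sharp`, `…ConstsCrossReachMeasureSharp.lean`, lane gen 17): for EVERY real `r < ½` a FOUR-vertex weighted
  graph — the series–parallel gadget `sx (p₁), xm (p₂), sm (q), mv (t)`, `S = {s}`, `T = {v}`, with the one-EDGE cluster events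
  `P = [sx ∈ C_S]`, `Q = [sm ∈ C_S]` — has `μ(S ↔ T) > r` and violates the row; there `X/2 = −p₁(1−p₁)p₂·q(1−q)·t(1−2t)` and
  `μ(S ↔ T) = t(q + p₁p₂ − qp₁p₂)` exactly (`Consts.crossReach_theta_lt`, `Consts.CrossReachSharp.cells`), so the row fails precisely when the
  bridge weight `t < ½`.  Thus the measure-level cross-reach row is a law of percolation exactly in the regime `μ(S ↔ T) ≥ ½`; for vertex
  events alone the largest violating `μ(S ↔ T)` is still open in `[0.09, ½)` (lane memo FINDING-gen17).  The stronger
  containment row IN (`E⊗E[1_U(ω₀) ∇a ∇b] ≥ 0`; IN ⟹ X ⟹ hard-core Harris at `N = T`) is not implied by Harris + BHK in ANY regime and,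
  for point events, not by the full proved four-point battery (pseudo-law `¼(δ_{s|x|y|v} + δ_{sxv|y} + δ_{syv|x} + δ_{sxyv})`, which has
  `μ(S ↔ v) = ¾`; lane memo FINDING-gen15).
[cite: VandenbergHaggstromKahn2005, Thm. 1.3 (p. 6) with Remark 1 after Thm. 1.2 (p. 5)] [cite: Harris1960, Lemma 4.1]
-/

noncomputable section

namespace Summit.CriticalPhenomena.PercolationContinuityZ3.Theorems

open MeasureTheory Set Literature.Probability.LatticeModels Literature.Probability.Percolation
open scoped Classical

namespace Consts

variable {V : Type*} [Fintype V]

/-- The real-arithmetic core of `crossReach_measure_of_disconnect_le`.  Block masses along `U ⊔ D` (`aU + aD = a` etc., `r + d = 1`),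
BHK on `D` (`aD·bD ≤ xD·d`), the mixed Harris bounds (`aD ≤ a·d`, `bD ≤ b·d`), Harris (`a·b ≤ x`) and `d ≤ r` give
`aU·bD + bU·aD ≤ xU·d + xD·r`.  Key identity: `d·(xU·d + xD·r − aU·bD − bU·aD) = d²(x − ab) + (r − d)(xD·d − aD·bD) + (a·d − aD)(b·d − bD)`.
[folklore] -/
theorem crossReach_half_algebra (a b x r d aU aD bU bD xU xD : ℝ)
    (hAdec : aU + aD = a) (hBdec : bU + bD = b) (hXdec : xU + xD = x) (hrd : r + d = 1)
    (h1 : aD * bD ≤ xD * d) (h2 : aD ≤ a * d) (h3 : bD ≤ b * d) (h4 : a * b ≤ x) (hdr : d ≤ r)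
    (n_d : 0 ≤ d) (n_aD : 0 ≤ aD) (n_bD : 0 ≤ bD) (n_xD : 0 ≤ xD)
    (le_aD : aD ≤ d) (le_bD : bD ≤ d) (le_xD : xD ≤ d) :
    aU * bD + bU * aD ≤ xU * d + xD * r := by
  have ea : aU = a - aD := by linarith
  have eb : bU = b - bD := by linarith
  have ex : xU = x - xD := by linarith
  have er : r = 1 - d := by linarith
  have key : 0 ≤ d * (xU * d + xD * r - aU * bD - bU * aD) := by
    have e : d * (xU * d + xD * r - aU * bD - bU * aD) =
        d ^ 2 * (x - a * b) + (r - d) * (xD * d - aD * bD) + (a * d - aD) * (b * d - bD) := by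
      rw [ea, eb, ex, er]; ring
    rw [e]
    have t1 : 0 ≤ d ^ 2 * (x - a * b) := mul_nonneg (sq_nonneg d) (by linarith)
    have t2 : 0 ≤ (r - d) * (xD * d - aD * bD) := mul_nonneg (by linarith) (by linarith)
    have t3 : 0 ≤ (a * d - aD) * (b * d - bD) := mul_nonneg (by linarith) (by linarith)
    linarith
  by_cases hd : d = 0
  · -- `D` null: every `D`-quantity vanishes and both sides are `0`
    have haD : aD = 0 := by linarith
    have hbD : bD = 0 := by linarith
    have hxD : xD = 0 := by linarith
    rw [haD, hbD, hxD, hd]; simp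
  · have hdpos : 0 < d := lt_of_le_of_ne n_d (Ne.symm hd)
    by_contra hneg
    have hlt : xU * d + xD * r - aU * bD - bU * aD < 0 := by linarith [lt_of_not_ge hneg]
    have : d * (xU * d + xD * r - aU * bD - bU * aD) < 0 := mul_neg_of_pos_of_neg hdpos hlt
    linarith

/-- **Cross-reach row at measure level when disconnection is not more likely than connection.**  For bond percolation
`μ = prodBernoulli w` on a finite vertex type, vertex sets `S, T`, `U = {S ↔ T}` (`∃ s ∈ S, ∃ t ∈ T, s ↔ t`), `D = {S ↮ T}`, and two
increasing events `A = {P(C_S)}`, `B = {Q(C_S)}` of the union cluster: if `μ(D) ≤ μ(U)` then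
`μ(A ∩ U)·μ(B ∩ D) + μ(B ∩ U)·μ(A ∩ D) ≤ μ(A ∩ B ∩ U)·μ(D) + μ(A ∩ B ∩ D)·μ(U)`,
i.e. `E⊗E[1_U(ω₀)·1_D(ω₁)·(1_A(ω₀) − 1_A(ω₁))·(1_B(ω₀) − 1_B(ω₁))] ≥ 0` for two independent copies (the lead's cross-reach row X(T),
`w = 1` stratum).  From Harris, BHK's Theorem 1.3 with sets, the mixed Harris bounds and `crossReach_half_algebra`; the hypothesis
`μ(D) ≤ μ(U)` cannot be dropped from THIS proof (for `μ(U) < ½` the row is not a consequence of these four inequalities), and the row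
itself is open in that regime.
[cite: VandenbergHaggstromKahn2005, Thm. 1.3 (p. 6) with Remark 1 after Thm. 1.2 (p. 5)] [cite: Harris1960, Lemma 4.1] -/
theorem crossReach_measure_of_disconnect_le (w : Sym2 V → unitInterval) (S T : Set V)
    (P Q : Set (Sym2 V) → Prop) (hP : ∀ ⦃C C' : Set (Sym2 V)⦄, C ⊆ C' → P C → P C')
    (hQ : ∀ ⦃C C' : Set (Sym2 V)⦄, C ⊆ C' → Q C → Q C')
    (hDU : (prodBernoulli w).real {ω : BondConfig V | ∀ s ∈ S, ∀ t ∈ T, ¬ (openGraph ω).Reachable s t} ≤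
      (prodBernoulli w).real {ω : BondConfig V | ∃ s ∈ S, ∃ t ∈ T, (openGraph ω).Reachable s t}) :
    (prodBernoulli w).real ({ω : BondConfig V | P (⋃ s ∈ S, openEdgeCluster ω s)} ∩
          {ω | ∃ s ∈ S, ∃ t ∈ T, (openGraph ω).Reachable s t}) *
        (prodBernoulli w).real ({ω : BondConfig V | Q (⋃ s ∈ S, openEdgeCluster ω s)} ∩
          {ω | ∀ s ∈ S, ∀ t ∈ T, ¬ (openGraph ω).Reachable s t}) +
      (prodBernoulli w).real ({ω : BondConfig V | Q (⋃ s ∈ S, openEdgeCluster ω s)} ∩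
          {ω | ∃ s ∈ S, ∃ t ∈ T, (openGraph ω).Reachable s t}) *
        (prodBernoulli w).real ({ω : BondConfig V | P (⋃ s ∈ S, openEdgeCluster ω s)} ∩
          {ω | ∀ s ∈ S, ∀ t ∈ T, ¬ (openGraph ω).Reachable s t}) ≤
    (prodBernoulli w).real ({ω : BondConfig V | P (⋃ s ∈ S, openEdgeCluster ω s)} ∩
          {ω | Q (⋃ s ∈ S, openEdgeCluster ω s)} ∩ {ω | ∃ s ∈ S, ∃ t ∈ T, (openGraph ω).Reachable s t}) *
        (prodBernoulli w).real {ω : BondConfig V | ∀ s ∈ S, ∀ t ∈ T, ¬ (openGraph ω).Reachable s t} +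
      (prodBernoulli w).real ({ω : BondConfig V | P (⋃ s ∈ S, openEdgeCluster ω s)} ∩
          {ω | Q (⋃ s ∈ S, openEdgeCluster ω s)} ∩ {ω | ∀ s ∈ S, ∀ t ∈ T, ¬ (openGraph ω).Reachable s t}) *
        (prodBernoulli w).real {ω : BondConfig V | ∃ s ∈ S, ∃ t ∈ T, (openGraph ω).Reachable s t} := by
  have hmeas : ∀ E : Set (BondConfig V), MeasurableSet E := fun _ => MeasurableSet.of_discrete
  -- `D = {S ↮ T}` is the complement of `U = {S ↔ T}`
  have hDU' : {ω : BondConfig V | ∀ s ∈ S, ∀ t ∈ T, ¬ (openGraph ω).Reachable s t} =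
      {ω : BondConfig V | ∃ s ∈ S, ∃ t ∈ T, (openGraph ω).Reachable s t}ᶜ := by
    ext ω
    simp only [mem_setOf_eq, mem_compl_iff, not_exists, not_and]
  -- monotonicity
  have hmonoC : ∀ ⦃ω ω' : BondConfig V⦄, ω ⊆ ω' →
      (⋃ s ∈ S, openEdgeCluster ω s) ⊆ (⋃ s ∈ S, openEdgeCluster ω' s) :=
    fun ω ω' hle => Set.iUnion₂_mono fun s _ => BHK2006.openEdgeCluster_mono hle s
  have hAup : IsUpperSet {ω : BondConfig V | P (⋃ s ∈ S, openEdgeCluster ω s)} :=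
    fun ω ω' hle hω => hP (hmonoC hle) hω
  have hBup : IsUpperSet {ω : BondConfig V | Q (⋃ s ∈ S, openEdgeCluster ω s)} :=
    fun ω ω' hle hω => hQ (hmonoC hle) hω
  have hDlow : IsLowerSet {ω : BondConfig V | ∀ s ∈ S, ∀ t ∈ T, ¬ (openGraph ω).Reachable s t} := by
    intro ω ω' hle hω s hs t ht hr
    exact hω s hs t ht (hr.mono (openGraph_mono hle))
  -- Harris, the two mixed bounds, BHK Theorem 1.3 with sets on `D`
  have h4 := prodBernoulli_harris_via_fibres w hAup hBup
  have h2 := prodBernoulli_harris_upper_lower_via_fibres w hAup hDlow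
  have h3 := prodBernoulli_harris_upper_lower_via_fibres w hBup hDlow
  have h1 := setClusterEventExchange w S T P Q (fun _ => True) (fun _ => True) hP hQ
    (fun _ _ _ _ => trivial) (fun _ _ _ _ => trivial)
  simp only [setOf_true, inter_univ] at h1
  rw [inter_comm {ω : BondConfig V | ∀ s ∈ S, ∀ t ∈ T, ¬ (openGraph ω).Reachable s t},
    inter_comm {ω : BondConfig V | ∀ s ∈ S, ∀ t ∈ T, ¬ (openGraph ω).Reachable s t},
    inter_comm {ω : BondConfig V | ∀ s ∈ S, ∀ t ∈ T, ¬ (openGraph ω).Reachable s t}] at h1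
  -- block decompositions along `U ⊔ D`
  have hAdec := measureReal_inter_add_sdiff (μ := prodBernoulli w)
    (s := {ω : BondConfig V | P (⋃ s ∈ S, openEdgeCluster ω s)}) (hmeas {ω : BondConfig V | ∃ s ∈ S, ∃ t ∈ T, (openGraph ω).Reachable s t})
  have hBdec := measureReal_inter_add_sdiff (μ := prodBernoulli w)
    (s := {ω : BondConfig V | Q (⋃ s ∈ S, openEdgeCluster ω s)}) (hmeas {ω : BondConfig V | ∃ s ∈ S, ∃ t ∈ T, (openGraph ω).Reachable s t})
  have hXdec := measureReal_inter_add_sdiff (μ := prodBernoulli w)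
    (s := {ω : BondConfig V | P (⋃ s ∈ S, openEdgeCluster ω s)} ∩ {ω : BondConfig V | Q (⋃ s ∈ S, openEdgeCluster ω s)})
    (hmeas {ω : BondConfig V | ∃ s ∈ S, ∃ t ∈ T, (openGraph ω).Reachable s t})
  have hURdec := measureReal_add_measureReal_compl (μ := prodBernoulli w)
    (hmeas {ω : BondConfig V | ∃ s ∈ S, ∃ t ∈ T, (openGraph ω).Reachable s t})
  rw [probReal_univ] at hURdec
  rw [Set.sdiff_eq, ← hDU'] at hAdec hBdec hXdec
  rw [← hDU'] at hURdec
  exact crossReach_half_algebra _ _ _ _ _ _ _ _ _ _ _ hAdec hBdec hXdec hURdec h1 h2 h3 h4 hDU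
    measureReal_nonneg measureReal_nonneg measureReal_nonneg measureReal_nonneg
    (measureReal_mono inter_subset_right) (measureReal_mono inter_subset_right) (measureReal_mono inter_subset_right)

end Consts

end Summit.CriticalPhenomena.PercolationContinuityZ3.Theorems
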